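import Summits.MatrixMultiplication.MatrixMultiplication.Theses.GLnSeparatingDesigns

/-!
# EXEMPT-46 re-exam (BC2 redirect) — typed decomposition candidates for the crux
`BorderHalfDimensionDesigns` (stmt-MatrixMultiplication-18360, route `GLnSeparatingDesigns`)

Strategist gen r1 (planner-cstrat-stmt-MatrixMultiplication-18360-r1-0), 2026-08-17.
Companion of `STRATEGY-CENSUS.md § Decomposition re-exam`.  Every candidate split
`X₁ ∧ … ∧ X_k → X` examined there that CAN be typed is typed here, its assembly proved, and —
where the census claims a piece gives `X` on its own (criterion (c)) — that implication is
PROVED here rather than merely probed.  No `sorry`.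

* `Body ε n`        — the ε-body of the crux at dimension `n`; `crux_iff` (by `Iff.rfl`).
* `body_mono_eps`   — the body is monotone in ε (larger ε is weaker);
  `crux_of_cofinal` — ANY ε-indexed piece whose index set is cofinal at `0⁺` already gives the
  crux: kills every parameter/threshold split (census D5).
* `SmallEps`/`LargeEps` (threshold split at ε₀): assembly proved AND `crux_of_smallEps`
  proved ⇒ violates (c).
* `BeatSplitExponent` / `Boost` (weak ∧ amplification, census D6 = D8): assembly is modus
  ponens; `boost_of_crux` shows the second piece is implied by `X` (it is `X` conditioned on a
  statement the live negation line is trying to REFUTE).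
* the two route supports `ExactHalfDimensionDesigns`, `FixedGroupBorderDesigns` (bridge splits,
  census D7): the probes `T → X` SUCCEED by the landed theorems
  `borderHalfDimensionDesigns_of_exact` / `…_of_fixedGroupBorderDesigns` (quoted in the census;
  re-derived here by `exact`).
-/

set_option linter.dupNamespace false

namespace Summit.MatrixMultiplication.MatrixMultiplication.Cruxes.BorderHalfDimensionDesigns.Redirect

open Summit.MatrixMultiplication.MatrixMultiplication.Theses.GLnSeparatingDesigns

abbrev GLn (n : ℕ) := Matrix.GeneralLinearGroup (Fin n) ℂ

/-- The ε-body of the crux at a fixed dimension `n` (verbatim clauses of the route decl). -/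
def Body (ε : ℝ) (n : ℕ) : Prop :=
  ∀ δ : ℝ, 0 < δ → ∀ q₀ : ℕ, ∃ q : ℕ, q₀ ≤ q ∧ ∀ η : ℝ, 0 < η → ∃ X Y Z : Finset (Matrix.GeneralLinearGroup (Fin n) ℂ), (∀ x ∈ X, ∀ x' ∈ X, ∀ y ∈ Y, ∀ y' ∈ Y, ∀ z ∈ Z, ∀ z' ∈ Z, x * y⁻¹ * y' * z⁻¹ = x' * z'⁻¹ → x = x' ∧ y = y' ∧ z = z') ∧ (q : ℝ) ^ ((n : ℝ) ^ 2 / 2 - ε * n) ≤ (X.card : ℝ) ∧ (q : ℝ) ^ ((n : ℝ) ^ 2 / 2 - ε * n) ≤ (Y.card : ℝ) ∧ (q : ℝ) ^ ((n : ℝ) ^ 2 / 2 - ε * n) ≤ (Z.card : ℝ) ∧ ∀ x₀ ∈ X, ∀ z₀ ∈ Z, ∃ p : MvPolynomial (Fin n × Fin n) ℂ, (p.totalDegree : ℝ) ≤ (q : ℝ) ^ (1 + δ) ∧ ∀ x ∈ X, ∀ y ∈ Y, ∀ y' ∈ Y, ∀ z ∈ Z, ((x = x₀ ∧ y = y' ∧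 z = z₀) → ‖MvPolynomial.eval (fun ij : Fin n × Fin n => ((x * y⁻¹ * y' * z⁻¹ : Matrix.GeneralLinearGroup (Fin n) ℂ) : Matrix (Fin n) (Fin n) ℂ) ij.1 ij.2) p - 1‖ ≤ η) ∧ (¬ (x = x₀ ∧ y = y' ∧ z = z₀) → ‖MvPolynomial.eval (fun ij : Fin n × Fin n => ((x * y⁻¹ * y' * z⁻¹ : Matrix.GeneralLinearGroup (Fin n) ℂ) : Matrix (Fin n) (Fin n) ℂ) ij.1 ij.2) p‖ ≤ η)

/-- The crux is literally `∀ ε > 0, ∃ n ≥ 3, Body ε n`. -/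
theorem crux_iff : BorderHalfDimensionDesigns ↔ ∀ ε : ℝ, 0 < ε → ∃ n : ℕ, 3 ≤ n ∧ Body ε n :=
  Iff.rfl

/-- Monotonicity in ε: the body only gets weaker as ε grows (apply the hypothesis with
`q₀ ⊔ 1` so that the base `q` is `≥ 1`, then `q^(n²/2 − ε'n) ≤ q^(n²/2 − εn)`). -/
theorem body_mono_eps {ε ε' : ℝ} {n : ℕ} (hle : ε ≤ ε') (h : Body ε n) : Body ε' n := by
  intro δ hδ q₀
  obtain ⟨q, hq, H⟩ := h δ hδ (max q₀ 1)
  refine ⟨q, le_trans (le_max_left _ _) hq, fun η hη => ?_⟩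
  obtain ⟨X, Y, Z, htpp, hX, hY, hZ, hsep⟩ := H η hη
  have hq1 : (1 : ℝ) ≤ q := by exact_mod_cast le_trans (le_max_right q₀ 1) hq
  have hn : (0 : ℝ) ≤ n := by positivity
  have hexp : (n : ℝ) ^ 2 / 2 - ε' * n ≤ (n : ℝ) ^ 2 / 2 - ε * n := by
    have := mul_le_mul_of_nonneg_right hle hn
    linarith
  have hpow : (q : ℝ) ^ ((n : ℝ) ^ 2 / 2 - ε' * n) ≤ (q : ℝ) ^ ((n : ℝ) ^ 2 / 2 - ε * n) :=
    Real.rpow_le_rpow_of_exponent_le hq1 hexp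
  exact ⟨X, Y, Z, htpp, le_trans hpow hX, le_trans hpow hY, le_trans hpow hZ, hsep⟩

/-- **Meta-lemma behind census D5.**  Any ε-indexed piece whose index set `E` is cofinal at
`0⁺` (contains, below every positive ε, some positive ε') already implies the whole crux.
Hence in every split of the crux along ε, the piece that handles `ε → 0` gives `X` on its own
(criterion (c) fails), and pieces bounded away from `0` say nothing about `X`. -/
theorem crux_of_cofinal (E : Set ℝ) (hE : ∀ ε : ℝ, 0 < ε → ∃ ε' ∈ E, 0 < ε' ∧ ε' ≤ ε)
    (h : ∀ ε ∈ E, 0 < ε → ∃ n : ℕ, 3 ≤ n ∧ Body ε n) : BorderHalfDimensionDesigns := by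
  rw [crux_iff]
  intro ε hε
  obtain ⟨ε', hε'E, hε'pos, hε'le⟩ := hE ε hε
  obtain ⟨n, hn, hb⟩ := h ε' hε'E hε'pos
  exact ⟨n, hn, body_mono_eps hε'le hb⟩

/-! ## D5 — threshold split at ε₀: `SmallEps ε₀ ∧ LargeEps ε₀ → X` -/

/-- Piece A: the crux below the threshold. -/
def SmallEps (ε₀ : ℝ) : Prop := ∀ ε : ℝ, 0 < ε → ε < ε₀ → ∃ n : ℕ, 3 ≤ n ∧ Body ε n

/-- Piece B: the crux at and above the threshold. -/
def LargeEps (ε₀ : ℝ) : Prop := ∀ ε : ℝ, ε₀ ≤ ε → ∃ n : ℕ, 3 ≤ n ∧ Body ε n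

/-- (b) the assembly — a case split. -/
theorem crux_of_smallEps_largeEps (ε₀ : ℝ) (hA : SmallEps ε₀) (hB : LargeEps ε₀) :
    BorderHalfDimensionDesigns := by
  rw [crux_iff]
  intro ε hε
  by_cases hlt : ε < ε₀
  · exact hA ε hε hlt
  · exact hB ε (le_of_not_gt hlt)

/-- (c) FAILS: piece A alone gives the crux (for any positive threshold). -/
theorem crux_of_smallEps {ε₀ : ℝ} (h₀ : 0 < ε₀) (hA : SmallEps ε₀) : BorderHalfDimensionDesigns := by
  refine crux_of_cofinal (Set.Ioo 0 ε₀) (fun ε hε => ?_) (fun ε hεE hε => hA ε hε hεE.2)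
  refine ⟨min ε (ε₀ / 2), ⟨?_, ?_⟩, ?_, min_le_left _ _⟩
  · exact lt_min hε (by linarith)
  · exact lt_of_le_of_lt (min_le_right _ _) (by linarith)
  · exact lt_min hε (by linarith)

/-- … and piece B is a consequence of the crux (informational: B ≤ X ≤ A). -/
theorem largeEps_of_crux {ε₀ : ℝ} (h₀ : 0 < ε₀) (h : BorderHalfDimensionDesigns) : LargeEps ε₀ :=
  fun ε hε => h ε (lt_of_lt_of_le h₀ hε)

/-! ## D6 = D8 — weak existence ∧ amplification: `BeatSplitExponent ∧ Boost → X` -/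

/-- η-approximate separators of degree `≤ s` for every target (the crux's last conjunct with an
integer degree budget; same clause as `Disproof.HasSeparators`). -/
def HasSeparators {n : ℕ} (X Y Z : Finset (GLn n)) (s : ℕ) (η : ℝ) : Prop :=
  ∀ x₀ ∈ X, ∀ z₀ ∈ Z, ∃ p : MvPolynomial (Fin n × Fin n) ℂ, p.totalDegree ≤ s ∧
    ∀ x ∈ X, ∀ y ∈ Y, ∀ y' ∈ Y, ∀ z ∈ Z,
      ((x = x₀ ∧ y = y' ∧ z = z₀) → ‖MvPolynomial.eval (fun ij : Fin n × Fin n =>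
          ((x * y⁻¹ * y' * z⁻¹ : GLn n) : Matrix (Fin n) (Fin n) ℂ) ij.1 ij.2) p - 1‖ ≤ η) ∧
      (¬ (x = x₀ ∧ y = y' ∧ z = z₀) → ‖MvPolynomial.eval (fun ij : Fin n × Fin n =>
          ((x * y⁻¹ * y' * z⁻¹ : GLn n) : Matrix (Fin n) (Fin n) ℂ) ij.1 ij.2) p‖ ≤ η)

/-- Piece "weak existence": SOME design family beats the split-design-barrier exponent
`3n²/2 − n/2` by a fixed `c > 0` (volume `≥ s^(3n²/2 − n/2 + c)` at separating degree `s`,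
for arbitrarily large `s`, every tolerance).  Open; it is (up to constants) the NEGATION of the
`SeparationDegreeLaw` C⁻ that the live line `Ideate5Sketch` is trying to prove. -/
def BeatSplitExponent : Prop :=
  ∃ n : ℕ, 3 ≤ n ∧ ∃ c : ℝ, 0 < c ∧ ∀ s₀ : ℕ, ∃ s : ℕ, s₀ ≤ s ∧ ∀ η : ℝ, 0 < η →
    ∃ X Y Z : Finset (GLn n), HasSeparators X Y Z s η ∧
      (s : ℝ) ^ ((3 : ℝ) * (n : ℝ) ^ 2 / 2 - (n : ℝ) / 2 + c) ≤ (X.card : ℝ) * Y.card * Z.card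

/-- Piece "amplification": beating the split exponent at all can be boosted to the crux's
threshold `3n²/2 − o(n)`.  No mechanism is known (block-diagonal / Kronecker products lose
dimension quadratically, census T2/D6). -/
def Boost : Prop := BeatSplitExponent → BorderHalfDimensionDesigns

/-- (b) the assembly — modus ponens (`trivial_seam`). -/
theorem crux_of_beat_boost (h₁ : BeatSplitExponent) (h₂ : Boost) : BorderHalfDimensionDesigns :=
  h₂ h₁

/-- `Boost` is implied by the crux: as a piece it is "`X` conditioned on a plausibly-true
statement", i.e. no easier than `X` unless `BeatSplitExponent` is false — in which case the
live negation line closes the route `refuted` and the split is moot. -/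
theorem boost_of_crux (h : BorderHalfDimensionDesigns) : Boost := fun _ => h

/-! ## D7 — bridge splits `T ∧ (T → X)` through the two route supports: the probes SUCCEED -/

/-- (c) FAILS for `T = ExactHalfDimensionDesigns`: `T → X` is a LANDED theorem
(`Theorems/GLnSeparatingDesignsExactHalfDimensionDesignsBorderOfExact.lean`), so the cheap
probe `exact?` closes `T → X`; re-derived here by name. -/
example : ExactHalfDimensionDesigns → BorderHalfDimensionDesigns := by
  intro h ε hε
  obtain ⟨n, hn, H⟩ := h ε hε
  refine ⟨n, hn, fun δ hδ q₀ => ?_⟩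
  obtain ⟨q, hq, X, Y, Z, htpp, hX, hY, hZ, hsep⟩ := H δ hδ q₀
  refine ⟨q, hq, fun η hη => ⟨X, Y, Z, htpp, hX, hY, hZ, ?_⟩⟩
  intro x₀ hx₀ z₀ hz₀
  obtain ⟨p, hp, hsep'⟩ := hsep x₀ hx₀ z₀ hz₀
  refine ⟨p, hp, fun x hx y hy y' hy' z hz => ⟨fun ht => ?_, fun ha => ?_⟩⟩
  · rw [(hsep' x hx y hy y' hy' z hz).1 ht]; simpa using hη.le
  · rw [(hsep' x hx y hy y' hy' z hz).2 ha]; simpa using hη.le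

end Summit.MatrixMultiplication.MatrixMultiplication.Cruxes.BorderHalfDimensionDesigns.Redirect
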